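/-
# Lattice sampling of Suzuki's screw function under «finitely many zeros off the line» — part B (§3)

(rh-split cell, seat rh-split-screw-bridge g11, 2026-08-27.)  Part B of the three-part carve of
`HOME/rh-split-screw-bridge/g11/ScrewLatticeFoz.lean` (sha16 eab9b912b5bab0ac): §3 = kernel
ll. 261–441 byte-identical, namespace re-opened (FQNs unchanged).  Nothing in this file is a claim
about the truth of RH.
-/
import Summits.RiemannHypothesis.RiemannHypothesis.Theorems.Splittings.ScrewLatticeFozA
import HarnessLib

/-!
# Part B — the terms of the zero series

Termwise bounds for `m(ρ)·(cosh((ρ-1/2)t) - 1)/(ρ-1/2)²`: the norm bound `norm_term_le`, the sign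
`re_coeff_neg` (`Re(m/(ρ-1/2)²) < 0`, from `|Im ρ| > 14`), and the top-layer expansion `re_term_top`.
-/

set_option linter.dupNamespace false

noncomputable section

open Complex Filter Topology Finset
open scoped ComplexConjugate

namespace Summit.RiemannHypothesis.RiemannHypothesis.Theorems.Splittings.ScrewLatticeFoz

open Literature.NumberTheory.LFunctions
open ZetaZeros.riemannZetaNontrivialZeros

/-! ## 3. The terms of the zero series -/

/-- `‖cosh w‖ ≤ e^{|Re w|}` (`private`: the statement restates the landed
`Literature.Analysis.Complex.norm_cosh_le_exp_abs_re` of `BochnerTubeGrowth.lean` — gate `dedup.landed`,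
typer-applied one-word repair per lead RULING #121, filing of lane (xii-i); proof bytes unchanged). [folklore] -/
private theorem norm_cosh_le (w : ℂ) : ‖Complex.cosh w‖ ≤ Real.exp |w.re| := by
  have h : Complex.cosh w = (Complex.exp w + Complex.exp (-w)) / 2 := rfl
  rw [h, norm_div, RCLike.norm_two]
  have h1 : ‖Complex.exp w‖ ≤ Real.exp |w.re| := by
    rw [Complex.norm_exp]
    exact Real.exp_le_exp.2 (le_abs_self _)
  have h2 : ‖Complex.exp (-w)‖ ≤ Real.exp |w.re| := by
    rw [Complex.norm_exp, neg_re]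
    exact Real.exp_le_exp.2 (neg_le_abs _)
  have h3 : ‖Complex.exp w + Complex.exp (-w)‖ ≤ ‖Complex.exp w‖ + ‖Complex.exp (-w)‖ :=
    norm_add_le _ _
  linarith

/-- Geometric decay of `e^{a k h}` along the lattice for `a < 0 < h`. -/
theorem tendsto_exp_lattice {a h : ℝ} (ha : a < 0) (hh : 0 < h) :
    Tendsto (fun k : ℕ ↦ Real.exp (a * (k * h))) atTop (𝓝 0) := by
  have hr : Real.exp (a * h) < 1 := Real.exp_lt_one_iff.2 (mul_neg_of_neg_of_pos ha hh)
  refine (tendsto_pow_atTop_nhds_zero_of_lt_one (Real.exp_pos (a * h)).le hr).congr fun k ↦ ?_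
  rw [← Real.exp_nat_mul]
  ring_nf

/-- `e^{-B k h} e^{a k h} → 0` along the lattice for `a < B`, `h > 0`. -/
theorem tendsto_exp_neg_mul_exp_lattice {a B h : ℝ} (ha : a < B) (hh : 0 < h) :
    Tendsto (fun k : ℕ ↦ Real.exp (-(B * (k * h))) * Real.exp (a * (k * h))) atTop (𝓝 0) := by
  refine (tendsto_exp_lattice (sub_neg.2 ha) hh).congr fun k ↦ ?_
  rw [← Real.exp_add]
  ring_nf

/-- Termwise bound in the zero series: for `t ≥ 0` and a non-trivial zero `ρ` with
`κ = ρ - 1/2 = σ + iγ`, `‖m(ρ)(cosh(κt) - 1)/κ²‖ ≤ e^{|σ| t} · 2m(ρ)/γ²`. -/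
theorem norm_term_le (ρ : ZetaZeros.riemannZetaNontrivialZeros) {t : ℝ} (ht : 0 ≤ t) :
    ‖(riemannZetaZeroOrder (ρ : ℂ) : ℂ) *
        ((Complex.cosh (((ρ : ℂ) - 1 / 2) * t) - 1) / ((ρ : ℂ) - 1 / 2) ^ 2)‖ ≤
      Real.exp (|(ρ : ℂ).re - 1 / 2| * t) *
        (2 * (riemannZetaZeroOrder (ρ : ℂ) : ℝ) / (ρ : ℂ).im ^ 2) := by
  have hm := FordL33.order_pos ρ
  have hγ : (ρ : ℂ).im ≠ 0 := im_ne_zero ρ.2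
  have hγ2 : 0 < (ρ : ℂ).im ^ 2 := by positivity
  set η : ℝ := |(ρ : ℂ).re - 1 / 2| with hη
  have hre : ((((ρ : ℂ) - 1 / 2) * t).re) = ((ρ : ℂ).re - 1 / 2) * t := by
    simp [sub_re, mul_re]
  have hnum : ‖Complex.cosh (((ρ : ℂ) - 1 / 2) * t) - 1‖ ≤ Real.exp (η * t) + 1 := by
    have h1 : ‖Complex.cosh (((ρ : ℂ) - 1 / 2) * t)‖ ≤ Real.exp (η * t) := by
      refine (norm_cosh_le _).trans (Real.exp_le_exp.2 (le_of_eq ?_))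
      rw [hre, abs_mul, abs_of_nonneg ht]
    calc ‖Complex.cosh (((ρ : ℂ) - 1 / 2) * t) - 1‖
        ≤ ‖Complex.cosh (((ρ : ℂ) - 1 / 2) * t)‖ + ‖(1 : ℂ)‖ := norm_sub_le _ _
      _ ≤ Real.exp (η * t) + 1 := by rw [norm_one]; linarith
  have hden : (ρ : ℂ).im ^ 2 ≤ ‖((ρ : ℂ) - 1 / 2) ^ 2‖ := by
    rw [norm_pow]
    have him : (((ρ : ℂ) - 1 / 2).im) = (ρ : ℂ).im := by simp [sub_im]
    have h := Complex.abs_im_le_norm ((ρ : ℂ) - 1 / 2)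
    rw [him] at h
    have h' : |(ρ : ℂ).im| ^ 2 ≤ ‖(ρ : ℂ) - 1 / 2‖ ^ 2 := pow_le_pow_left₀ (abs_nonneg _) h 2
    rwa [sq_abs] at h'
  have hA : 0 ≤ Real.exp (η * t) + 1 := by positivity
  have hE1 : 1 ≤ Real.exp (η * t) := Real.one_le_exp (by positivity)
  rw [norm_mul, norm_div, Complex.norm_intCast, abs_of_pos hm]
  have hfrac : ‖Complex.cosh (((ρ : ℂ) - 1 / 2) * t) - 1‖ / ‖((ρ : ℂ) - 1 / 2) ^ 2‖ ≤
      (Real.exp (η * t) + 1) / (ρ : ℂ).im ^ 2 :=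
    div_le_div₀ hA hnum hγ2 hden
  calc (riemannZetaZeroOrder (ρ : ℂ) : ℝ) *
        (‖Complex.cosh (((ρ : ℂ) - 1 / 2) * t) - 1‖ / ‖((ρ : ℂ) - 1 / 2) ^ 2‖)
      ≤ (riemannZetaZeroOrder (ρ : ℂ) : ℝ) * ((Real.exp (η * t) + 1) / (ρ : ℂ).im ^ 2) :=
        mul_le_mul_of_nonneg_left hfrac hm.le
    _ = (Real.exp (η * t) + 1) / 2 * (2 * (riemannZetaZeroOrder (ρ : ℂ) : ℝ) / (ρ : ℂ).im ^ 2) := by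
        ring
    _ ≤ Real.exp (η * t) * (2 * (riemannZetaZeroOrder (ρ : ℂ) : ℝ) / (ρ : ℂ).im ^ 2) := by
        have h2 : (Real.exp (η * t) + 1) / 2 ≤ Real.exp (η * t) := by linarith
        have h3 : 0 ≤ 2 * (riemannZetaZeroOrder (ρ : ℂ) : ℝ) / (ρ : ℂ).im ^ 2 := by positivity
        exact mul_le_mul_of_nonneg_right h2 h3

/-- The coefficient `c_ρ = m(ρ)/κ²` has negative real part for every non-trivial zero:
`Re κ² = σ² - γ² < 0` because `|σ| < 1/2 < 14 < |γ|` (`FordL33.fourteen_lt_abs_im`). -/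
theorem re_coeff_neg (ρ : ZetaZeros.riemannZetaNontrivialZeros) :
    ((riemannZetaZeroOrder (ρ : ℂ) : ℂ) / ((ρ : ℂ) - 1 / 2) ^ 2).re < 0 := by
  have hm := FordL33.order_pos ρ
  have him : 14 < |(ρ : ℂ).im| := FordL33.fourteen_lt_abs_im ρ
  have h0 := re_pos ρ.2
  have h1 := re_lt_one ρ.2
  set κ : ℂ := (ρ : ℂ) - 1 / 2 with hκ
  have hκre : κ.re = (ρ : ℂ).re - 1 / 2 := by simp [hκ]
  have hκim : κ.im = (ρ : ℂ).im := by simp [hκ]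
  have hsq_re : (κ ^ 2).re = κ.re ^ 2 - κ.im ^ 2 := by rw [sq, Complex.mul_re]; ring
  have hneg : (κ ^ 2).re < 0 := by
    rw [hsq_re, hκre, hκim]
    have h14 : |(ρ : ℂ).re - 1 / 2| < |(ρ : ℂ).im| := by
      have : |(ρ : ℂ).re - 1 / 2| < 1 / 2 := abs_lt.2 ⟨by linarith, by linarith⟩
      linarith
    have := sq_lt_sq.2 h14
    linarith
  have hκ0 : κ ^ 2 ≠ 0 := fun h ↦ by rw [h] at hneg; simp at hneg
  have hcast : (riemannZetaZeroOrder (ρ : ℂ) : ℂ) = ((riemannZetaZeroOrder (ρ : ℂ) : ℝ) : ℂ) := by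
    push_cast; rfl
  rw [div_eq_mul_inv, hcast, Complex.re_ofReal_mul, Complex.inv_re]
  have hns : 0 < Complex.normSq (κ ^ 2) := Complex.normSq_pos.2 hκ0
  exact mul_neg_of_pos_of_neg hm (div_neg_of_neg_of_pos hneg hns)

/-- **Top-layer form of a term.** For a non-trivial zero `ρ` with `κ = ρ - 1/2 = σ + iγ` put
`λ = sgn(σ)·γ` and `c = m/κ²`.  Then for `t ≥ 0`
`|Re[m (cosh κt - 1)/κ²] - (e^{|σ|t}/2)·Re[c e^{iλt}]| ≤ 2‖c‖`
(`cosh κt = cosh νt`, `κ² = ν²` with `ν = |σ| + iλ = ±κ`, and `e^{νt} = e^{|σ|t} e^{iλt}`). -/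
theorem re_term_top (ρ : ZetaZeros.riemannZetaNontrivialZeros) {t : ℝ} (ht : 0 ≤ t) :
    |((riemannZetaZeroOrder (ρ : ℂ) : ℂ) *
        ((Complex.cosh (((ρ : ℂ) - 1 / 2) * t) - 1) / ((ρ : ℂ) - 1 / 2) ^ 2)).re -
      Real.exp (|(ρ : ℂ).re - 1 / 2| * t) / 2 *
        ((riemannZetaZeroOrder (ρ : ℂ) : ℂ) / ((ρ : ℂ) - 1 / 2) ^ 2 *
          Complex.exp ((((if 1 / 2 ≤ (ρ : ℂ).re then (ρ : ℂ).im else -(ρ : ℂ).im) * t : ℝ) : ℂ) *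
            I)).re| ≤
      2 * ‖(riemannZetaZeroOrder (ρ : ℂ) : ℂ) / ((ρ : ℂ) - 1 / 2) ^ 2‖ := by
  set m : ℂ := (riemannZetaZeroOrder (ρ : ℂ) : ℂ) with hm
  set κ : ℂ := (ρ : ℂ) - 1 / 2 with hκ
  set B : ℝ := |(ρ : ℂ).re - 1 / 2| with hB
  set lam : ℝ := (if 1 / 2 ≤ (ρ : ℂ).re then (ρ : ℂ).im else -(ρ : ℂ).im) with hlam
  set ν : ℂ := (B : ℂ) + (lam : ℂ) * I with hν
  have hB0 : 0 ≤ B := abs_nonneg _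
  -- `κ = ± ν`
  have hκν : κ = ν ∨ κ = -ν := by
    by_cases hcase : 1 / 2 ≤ (ρ : ℂ).re
    · left
      have hB' : B = (ρ : ℂ).re - 1 / 2 := by rw [hB]; exact abs_of_nonneg (by linarith)
      have hlam' : lam = (ρ : ℂ).im := by rw [hlam, if_pos hcase]
      apply Complex.ext <;> simp [hκ, hν, hB', hlam']
    · right
      have hcase' : (ρ : ℂ).re < 1 / 2 := not_le.1 hcase
      have hB' : B = -((ρ : ℂ).re - 1 / 2) := by rw [hB]; exact abs_of_neg (by linarith)
      have hlam' : lam = -(ρ : ℂ).im := by rw [hlam, if_neg hcase]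
      apply Complex.ext <;> simp [hκ, hν, hB', hlam']
  have hcosh : Complex.cosh (κ * t) = Complex.cosh (ν * t) := by
    rcases hκν with h | h
    · rw [h]
    · rw [h, neg_mul, Complex.cosh_neg]
  have hsq : κ ^ 2 = ν ^ 2 := by
    rcases hκν with h | h
    · rw [h]
    · rw [h, neg_sq]
  set c : ℂ := m / κ ^ 2 with hc
  -- the identity `term = c e^{νt}/2 + c (e^{-νt}/2 - 1)`
  have hterm : m * ((Complex.cosh (κ * t) - 1) / κ ^ 2) =
      c * Complex.exp (ν * t) / 2 + c * (Complex.exp (-(ν * t)) / 2 - 1) := by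
    have hcosh' : Complex.cosh (ν * t) = (Complex.exp (ν * t) + Complex.exp (-(ν * t))) / 2 := rfl
    rw [hcosh, hcosh', hc]
    ring
  -- `e^{νt} = e^{Bt} e^{iλt}`
  have hexp : Complex.exp (ν * t) = (Real.exp (B * t) : ℂ) * Complex.exp (((lam * t : ℝ) : ℂ) * I) := by
    rw [Complex.ofReal_exp, ← Complex.exp_add, hν]
    push_cast
    ring_nf
  have hre1 : (c * Complex.exp (ν * t) / 2).re =
      Real.exp (B * t) / 2 * (c * Complex.exp (((lam * t : ℝ) : ℂ) * I)).re := by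
    rw [hexp, re_div_two]
    have h' : c * ((Real.exp (B * t) : ℂ) * Complex.exp (((lam * t : ℝ) : ℂ) * I)) =
        (Real.exp (B * t) : ℂ) * (c * Complex.exp (((lam * t : ℝ) : ℂ) * I)) := by ring
    rw [h', Complex.re_ofReal_mul]
    ring
  -- the remainder is `≤ 2‖c‖`
  have hrest : ‖c * (Complex.exp (-(ν * t)) / 2 - 1)‖ ≤ 2 * ‖c‖ := by
    rw [norm_mul]
    have he : ‖Complex.exp (-(ν * t))‖ ≤ 1 := by
      rw [Complex.norm_exp]
      have hre : (-(ν * (t : ℂ))).re = -(B * t) := by simp [hν]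
      rw [hre]
      exact Real.exp_le_one_iff.2 (by nlinarith)
    have h1 : ‖Complex.exp (-(ν * t)) / 2 - 1‖ ≤ 2 := by
      calc ‖Complex.exp (-(ν * t)) / 2 - 1‖
          ≤ ‖Complex.exp (-(ν * t)) / 2‖ + ‖(1 : ℂ)‖ := norm_sub_le _ _
        _ = ‖Complex.exp (-(ν * t))‖ / 2 + 1 := by rw [norm_div, RCLike.norm_two, norm_one]
        _ ≤ 2 := by linarith
    calc ‖c‖ * ‖Complex.exp (-(ν * t)) / 2 - 1‖ ≤ ‖c‖ * 2 := by gcongr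
      _ = 2 * ‖c‖ := mul_comm _ _
  rw [hterm, Complex.add_re, hre1]
  have hcancel : Real.exp (B * t) / 2 * (c * Complex.exp (((lam * t : ℝ) : ℂ) * I)).re +
      (c * (Complex.exp (-(ν * t)) / 2 - 1)).re -
      Real.exp (B * t) / 2 * (c * Complex.exp (((lam * t : ℝ) : ℂ) * I)).re =
      (c * (Complex.exp (-(ν * t)) / 2 - 1)).re := by ring
  rw [hcancel]
  exact (Complex.abs_re_le_norm _).trans hrest


end Summit.RiemannHypothesis.RiemannHypothesis.Theorems.Splittings.ScrewLatticeFoz
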